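import Summits.ResolutionOfSingularities.ResolutionOfSingularities.Theorems.HilbertSamuelEliminationSigmaMaxModificationsCorridor3SigmaTameLowSncBranchLineage
import HarnessLib

/-!
# [OURS · L1 W4.2] TAME-LOW row T-L4 «SNC PHASE, lineage-local» — part 4e (singular-branch half): LINEAGE DATA AS A RECORD, the COHERENT
# CHAIN of points `θₙ : R n → L` of a branch (while it passes through the lineage point), and DISTINCTNESS PERSISTENCE — non-associated
# branches stay non-associated, and a branch coming from stage `0` never coincides with an exceptional curve born later
# (cell res-hironaka, LADDER-RESOLUTION rung L; slot W4.2, crux chain w42 `SigmaMaxModificationsCorridor3` stmt-ResolutionOfSingularities-19249 /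
# crux `SigmaMaxModifications` stmt-…-18506; res-L1-w42-plan-1 RULING v3.14-48 (PD)(iv)/(PF) row T-L4 → res-L1-w42-stub-4 (gen 7);
# `--supports stmt-ResolutionOfSingularities-19249 --as helper`; consumers: the assembly of part 3's hypotheses (regular entry stage: part 4d;
# distinctness: this file + part 4d `contactOrder_ne_top_of_not_dvd`), res-L1-type-o2 (T-L2/T-L6 readings))

HONEST FRAMING.  OURS bookkeeping for the TAME-LOW tier (RULING v3.14-48 (PD)(iv)), built on parts 4a–4d (the point at stage `n + 1` is
part 4b's `branchLift` of the point at stage `n`). Nothing here is a statement of H. Hironaka's manuscript [Hironaka2017] (CANDIDATE, never a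
premise) nor of Cossart–Jannsen–Saito; no named fact; every theorem PROVED; ONE bookkeeping instance (`PointLineage.R n` is regular local, read
off the record). AI-written; weaker than expert review.

RECORDS.  `PointLineage K` — a lineage of point blow-ups through two-dimensional regular local rings of `K`: `R n`, `R (n+1)` a quadratic
transform of `R n` in the chart of `x n ∈ 𝔪_{R n} ∖ 0` (`R n[𝔪/x n] ⊆ R (n+1)`). `P.Branch L` — a branch followed along `P`: `f n ∈ P.R n`,
`f 0 ≠ 0`, STRICT-TRANSFORM rule `f (n+1) = f n / (x n)^{ord f n}` (`ord = contactOrder 0`), and a point `θ₀ : R 0 → L` of it (`ker θ₀ = (f 0)`,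
`θ₀(R 0)` a local ring of `L` with module-finite normalisation — supplied by excellence of the ambient scheme).

* `Branch.Passes n` (`f k ∈ 𝔪` for `k ≤ n`), `PointLineage.frame_eq` (a chosen frame `(x n, y n)`), `Branch.ne_zero`, `Branch.ord_mem/ord_not_mem`,
  `Branch.theta_chart_ne_zero` (a point with kernel `(f n)` does not kill `x n` if the branch passes stage `n + 1`).
* `Branch.IsPoint n θ`; `Branch.exists_point_succ` (part 4b's `branchLift`, with coherence); **`Branch.chain n h`** — THE CHAIN of points;
  `chain_succ_apply`, `chain_apply_of_le` (coherence), `chain_chart_ne_zero` (`θₙ (x k) ≠ 0`, `k < n`), `not_dvd_of_chain_ne_zero`,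
  `chain_div_ne_zero` — **no strict transform of the branch divides an exceptional branch or its later strict transforms**.
* **`Branch.not_dvd_of_passes`** — for two branches `B, C` of `P`: `B.f 0 ∤ C.f 0 ⇒ B.f n ∤ C.f n` while `B` passes (part 4d
  `not_dvd_strictTransform` along the chain).
* **`Branch.exists_not_mem_or_isRegularBranch`** — part 4d's branch lineage theorem for the record.

References: J. Kollár (2007), §1.4 [Kollar2007]; M. Herrmann, S. Ikeda, U. Orbanz (1988), Thm. (30.2) [HerrmannIkedaOrbanz1988].
-/

noncomputable section

set_option linter.dupNamespace false -- mandated namespace of this single-conjunct summit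

open IsLocalRing Literature.AlgebraicGeometry.Resolution

namespace Summit.ResolutionOfSingularities.ResolutionOfSingularities.Theorems.SigmaMaxModificationsCorridor3.TameLowSnc

universe u v w

/-- **A lineage of point blow-ups** through two-dimensional regular local rings of `K`: `R (n+1)` is a quadratic transform of `R n` lying
in the chart of the non-zero element `x n ∈ 𝔪_{R n}` (`R n[𝔪/x n] ⊆ R (n+1)`). [OURS · L1 W4.2 bookkeeping] -/
structure PointLineage (K : Type u) [Field K] : Type u where
  /-- the local rings of the lineage points -/
  R : ℕ → Subring K
  /-- each is a regular local ring … -/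
  isRegular : ∀ n, IsRegularLocalRing (R n)
  /-- … of dimension two -/
  dim_eq : ∀ n, ringKrullDim (R n) = 2
  /-- each step is a quadratic transform (a point of the blow-up of the previous point) -/
  quadratic : ∀ n, IsQuadraticTransform (R n) (R (n + 1))
  /-- the chart elements -/
  x : ℕ → K
  x_mem : ∀ n, x n ∈ R n
  x_mem_maximalIdeal : ∀ n, haveI := isRegular n; (⟨x n, x_mem n⟩ : R n) ∈ maximalIdeal (R n)
  x_ne_zero : ∀ n, x n ≠ 0
  blowupRing_le : ∀ n, haveI := isRegular n; blowupRing (R n) (x n) ≤ R (n + 1)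

namespace PointLineage

variable {K : Type u} [Field K] (P : PointLineage K)

/-- The local rings of a point lineage are regular local rings (read off the record). [OURS · bookkeeping instance] -/
instance instIsRegularLocalRing (n : ℕ) : IsRegularLocalRing (P.R n) := P.isRegular n

/-- The chart element as a member of `R n`. [OURS · bookkeeping] -/
abbrev xR (n : ℕ) : P.R n := ⟨P.x n, P.x_mem n⟩

/-- `xR n ≠ 0`. [OURS · proved] -/
theorem xR_ne_zero (n : ℕ) : P.xR n ≠ 0 := fun h => P.x_ne_zero n (congrArg Subtype.val h)

/-- `x n ∉ 𝔪²`. [OURS · proved] -/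
theorem xR_not_mem_sq (n : ℕ) : P.xR n ∉ maximalIdeal (P.R n) ^ 2 :=
  IsQuadraticTransform.chart_not_mem_sq (P.blowupRing_le n) (P.quadratic n).dominates (P.xR_ne_zero n)

/-- A chosen second regular parameter: `𝔪_{R n} = (x n, y n)`. [OURS · bookkeeping] -/
def y (n : ℕ) : P.R n :=
  Classical.choose (exists_maximalIdeal_eq_span_pair_of_not_mem_sq (P.dim_eq n) (P.x_mem_maximalIdeal n) (P.xR_not_mem_sq n))

/-- `𝔪_{R n} = (x n, y n)`. [OURS · proved] -/
theorem frame_eq (n : ℕ) : maximalIdeal (P.R n) = Ideal.span {P.xR n, P.y n} :=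
  (Classical.choose_spec (exists_maximalIdeal_eq_span_pair_of_not_mem_sq (P.dim_eq n) (P.x_mem_maximalIdeal n)
    (P.xR_not_mem_sq n))).1

/-- The lineage is increasing. [OURS · proved] -/
theorem le_of_le {k n : ℕ} (hkn : k ≤ n) : P.R k ≤ P.R n := by
  induction n, hkn using Nat.le_induction with
  | base => exact le_rfl
  | succ n _ ih => exact ih.trans (P.quadratic n).dominates.1

/-- **A branch followed along the lineage**: `f n ∈ R n`, `f 0 ≠ 0`, the strict-transform rule `f (n+1) = f n / (x n)^{ord f n}`
(`ord = contactOrder 0`), and a point `θ₀ : R 0 → L` of the branch with `ker θ₀ = (f 0)` whose image is a local ring of `L` with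
module-finite normalisation. [OURS · L1 W4.2 bookkeeping] -/
structure Branch (L : Type v) [Field L] : Type (max u v) where
  /-- the strict transforms -/
  f : ℕ → K
  f_mem : ∀ n, f n ∈ P.R n
  f_zero_ne : f 0 ≠ 0
  /-- strict-transform rule -/
  f_succ : ∀ n, f (n + 1) = f n / P.x n ^ (contactOrder (0 : P.R n) ⟨f n, f_mem n⟩).toNat
  /-- a point of the branch at stage `0` -/
  θ₀ : P.R 0 →+* L
  ker_θ₀ : RingHom.ker θ₀ = Ideal.span {(⟨f 0, f_mem 0⟩ : P.R 0)}
  isLocalRingOf_θ₀ : IsLocalRingOf θ₀.range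
  finite_θ₀ : Module.Finite θ₀.range (integralClosure θ₀.range L)

end PointLineage

namespace PointLineage.Branch

variable {K : Type u} [Field K] {P : PointLineage K} {L : Type v} [Field L] (B : P.Branch L)

/-- The strict transform as a member of `R n`. [OURS · bookkeeping] -/
abbrev fR (n : ℕ) : P.R n := ⟨B.f n, B.f_mem n⟩

/-- `f n ≠ 0`. [OURS · proved] -/
theorem fR_ne_zero (n : ℕ) : B.fR n ≠ 0 := by
  suffices h : B.f n ≠ 0 from fun e => h (congrArg Subtype.val e)
  induction n with
  | zero => exact B.f_zero_ne
  | succ n ih => rw [B.f_succ n]; exact div_ne_zero ih (pow_ne_zero _ (P.x_ne_zero n))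

/-- `f n ∈ 𝔪^{ord}` and `f n ∉ 𝔪^{ord+1}`. [OURS · proved] -/
theorem ord_mem_and_not_mem (n : ℕ) :
    B.fR n ∈ maximalIdeal (P.R n) ^ (contactOrder (0 : P.R n) (B.fR n)).toNat ∧
      B.fR n ∉ maximalIdeal (P.R n) ^ ((contactOrder (0 : P.R n) (B.fR n)).toNat + 1) := by
  obtain ⟨m, hm⟩ := ENat.ne_top_iff_exists.mp (contactOrder_zero_ne_top (B.fR_ne_zero n))
  rw [← hm, ENat.toNat_coe]
  exact (contactOrder_zero_iff _ m).mp hm.symm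

/-- **The branch passes through the lineage points `0, …, n`.** [OURS · bookkeeping] -/
def Passes (n : ℕ) : Prop := ∀ k, k ≤ n → B.fR k ∈ maximalIdeal (P.R k)

variable {B} in
/-- Monotonicity of `Passes`. [OURS · proved] -/
theorem Passes.of_succ {n : ℕ} (h : B.Passes (n + 1)) : B.Passes n := fun k hk => h k (Nat.le_succ_of_le hk)

variable {B} in
/-- Monotonicity of `Passes`. [OURS · proved] -/
theorem Passes.of_le {k n : ℕ} (h : B.Passes n) (hkn : k ≤ n) : B.Passes k := fun j hj => h j (hj.trans hkn)

/-- The strict transform at stage `n + 1` is `f n / (x n)^{ord}`, as members of `R (n+1)`. [OURS · proved] -/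
theorem fR_succ_eq (n : ℕ) (h : B.f n / P.x n ^ (contactOrder (0 : P.R n) (B.fR n)).toNat ∈ P.R (n + 1)) :
    (⟨_, h⟩ : P.R (n + 1)) = B.fR (n + 1) := Subtype.ext (B.f_succ n).symm

/-- **A point with kernel `(f n)` does not kill `x n` if the branch passes through stage `n + 1`** (else `f n ~ x n` has order one and
`f (n+1)` is a unit). [OURS · proved] -/
theorem theta_chart_ne_zero (n : ℕ) (θ : P.R n →+* L) (hker : RingHom.ker θ = Ideal.span {B.fR n})
    (hpass : B.fR (n + 1) ∈ maximalIdeal (P.R (n + 1))) : θ (P.xR n) ≠ 0 := by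
  intro h0
  have hxker : P.xR n ∈ RingHom.ker θ := h0
  rw [hker, Ideal.mem_span_singleton'] at hxker
  obtain ⟨c, hc⟩ := hxker
  have hx2 := P.xR_not_mem_sq n
  -- `f n ∈ 𝔪`: otherwise `ord = 0` and `f (n+1) = f n` is a unit
  have hfm : B.fR n ∈ maximalIdeal (P.R n) := by
    by_contra hfu
    apply (mem_maximalIdeal _).mp hpass
    have hfunit : IsUnit (B.fR n) := not_not.mp fun h => hfu ((mem_maximalIdeal _).mpr h)
    have hord : contactOrder (0 : P.R n) (B.fR n) = 0 := contactOrder_eq_zero_of_not_mem (Ideal.zero_mem _) hfu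
    have e : B.fR (n + 1) = Subring.inclusion (P.quadratic n).dominates.1 (B.fR n) :=
      Subtype.ext (by change B.f (n + 1) = B.f n; rw [B.f_succ n, hord, ENat.toNat_zero, pow_zero, div_one])
    rw [e]; exact hfunit.map _
  -- `c` is a unit
  have hcu : IsUnit c := by
    by_contra hcu
    apply hx2
    rw [← hc, pow_two]
    exact Ideal.mul_mem_mul ((mem_maximalIdeal _).mpr hcu) hfm
  obtain ⟨u, hu⟩ := hcu
  have hfx : B.f n = P.x n * ((↑u⁻¹ : P.R n) : K) := by
    have e := congrArg (fun t : P.R n => (t : K)) hc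
    simp only [Subring.coe_mul] at e
    change (c : K) * B.f n = P.x n at e
    rw [← e, ← hu, mul_comm ((u : P.R n) : K), mul_assoc, ← Subring.coe_mul, Units.mul_inv, Subring.coe_one, mul_one]
  have hford : contactOrder (0 : P.R n) (B.fR n) = 1 := by
    rw [← Nat.cast_one, contactOrder_zero_iff]
    have e : B.fR n = P.xR n * ↑u⁻¹ := Subtype.ext hfx
    rw [e, pow_one]
    refine ⟨Ideal.mul_mem_right _ _ (P.x_mem_maximalIdeal n), fun h2 => hx2 ?_⟩
    have : P.xR n = P.xR n * ↑u⁻¹ * ↑u := by rw [mul_assoc, Units.inv_mul, mul_one]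
    rw [this]; exact Ideal.mul_mem_right _ _ h2
  apply (mem_maximalIdeal _).mp hpass
  have e : B.fR (n + 1) = Subring.inclusion (P.quadratic n).dominates.1 (↑u⁻¹ : P.R n) := Subtype.ext (by
    change B.f (n + 1) = ((↑u⁻¹ : P.R n) : K)
    rw [B.f_succ n, hford, ENat.toNat_one, pow_one, hfx, mul_div_cancel_left₀ _ (P.x_ne_zero n)])
  rw [e]
  exact (Units.isUnit _).map _

/-! ### The chain of points -/

/-- **A point of the branch at stage `n`**: `ker θ = (f n)`, `θ(R n)` a local ring of `L` with module-finite normalisation.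
[OURS · bookkeeping] -/
def IsPoint (n : ℕ) (θ : P.R n →+* L) : Prop :=
  RingHom.ker θ = Ideal.span {B.fR n} ∧ IsLocalRingOf θ.range ∧ Module.Finite θ.range (integralClosure θ.range L)

/-- `θ₀` is a point at stage `0`. [OURS · proved] -/
theorem isPoint_zero : B.IsPoint 0 B.θ₀ := ⟨B.ker_θ₀, B.isLocalRingOf_θ₀, B.finite_θ₀⟩

/-- One step: part 4b's `branchLift` of a point at stage `n` (when the branch passes through stage `n + 1`) is a point at stage
`n + 1`, coherent with it, and its `δ` is smaller if the germ at stage `n` is singular. [OURS · proved] -/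
theorem exists_point_succ (n : ℕ) (hpass : B.Passes (n + 1)) {θ : P.R n →+* L} (hθ : B.IsPoint n θ) :
    ∃ θ' : P.R (n + 1) →+* L, B.IsPoint (n + 1) θ' ∧
      (∀ r : P.R n, θ' (Subring.inclusion (P.quadratic n).dominates.1 r) = θ r) ∧
      ((haveI := isLocalRing_range θ; ¬ IsDiscreteValuationRing θ.range) →
        (curveDelta θ'.range L).toNat < (curveDelta θ.range L).toNat) := by
  obtain ⟨hker, hof, hfin⟩ := hθ
  have hm := P.frame_eq n
  have hθx := B.theta_chart_ne_zero n θ hker (hpass (n + 1) le_rfl)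
  obtain ⟨hfm, hfm1⟩ := B.ord_mem_and_not_mem n
  have hfmem : B.fR n ∈ maximalIdeal (P.R n) := hpass n (Nat.le_succ n)
  have hst : B.f n / P.x n ^ (contactOrder (0 : P.R n) (B.fR n)).toNat = B.f (n + 1) := (B.f_succ n).symm
  have hf₁mem : B.f n / P.x n ^ (contactOrder (0 : P.R n) (B.fR n)).toNat ∈ P.R (n + 1) := hst ▸ B.f_mem (n + 1)
  have e : (⟨_, hf₁mem⟩ : P.R (n + 1)) = B.fR (n + 1) := Subtype.ext hst
  have hf₁ : (⟨_, hf₁mem⟩ : P.R (n + 1)) ∈ maximalIdeal (P.R (n + 1)) := by rw [e]; exact hpass (n + 1) le_rfl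
  refine ⟨branchLift (P.dim_eq n) hm (P.quadratic n) (P.blowupRing_le n) θ hθx hker hfm hfm1 hf₁, ⟨?_, ?_⟩,
    branchLift_inclusion (P.dim_eq n) hm (P.quadratic n) (P.blowupRing_le n) θ hθx hker hfm hfm1 hf₁, fun hsing => ?_⟩
  · have h := ker_branchLift (P.dim_eq n) hm (P.quadratic n) (P.blowupRing_le n) θ hθx hker hfm hfm1 hf₁
    rw [e] at h; exact h
  · obtain ⟨hofψ, -, -, hfinψ⟩ := curveGerm_range_branchLift (P.dim_eq n) hm (P.quadratic n) (P.blowupRing_le n) θ hθx hker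
      hfm hfm1 hfmem hf₁ hof hfin
    exact ⟨hofψ, hfinψ⟩
  · exact toNat_curveDelta_range_branchLift_lt (P.dim_eq n) hm (P.quadratic n) (P.blowupRing_le n) θ hθx hker hfm hfm1
      hfmem hf₁ hof hfin hsing

/-- **THE CHAIN OF POINTS OF THE BRANCH** along the lineage, while it passes: `θ₀` at stage `0`, and part 4b's `branchLift` at each step
(chosen from `exists_point_succ`; coherence in `chain_succ_apply`). [OURS · L1 W4.2 bookkeeping] -/
def chain : (n : ℕ) → B.Passes n → {θ : P.R n →+* L // B.IsPoint n θ}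
  | 0, _ => ⟨B.θ₀, B.isPoint_zero⟩
  | n + 1, h =>
    ⟨Classical.choose (B.exists_point_succ n h (chain n h.of_succ).2),
      (Classical.choose_spec (B.exists_point_succ n h (chain n h.of_succ).2)).1⟩

/-- **Coherence**: `θₙ₊₁ (r) = θₙ (r)` for `r ∈ R n`. [OURS · proved] -/
theorem chain_succ_apply (n : ℕ) (h : B.Passes (n + 1)) (r : P.R n) :
    (B.chain (n + 1) h).1 (Subring.inclusion (P.quadratic n).dominates.1 r) = (B.chain n h.of_succ).1 r :=
  (Classical.choose_spec (B.exists_point_succ n h (B.chain n h.of_succ).2)).2.1 r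

/-- **`δ` drops along the chain at a singular stage.** [OURS · proved] -/
theorem chain_succ_delta_lt (n : ℕ) (h : B.Passes (n + 1))
    (hsing : haveI := isLocalRing_range (B.chain n h.of_succ).1; ¬ IsDiscreteValuationRing (B.chain n h.of_succ).1.range) :
    (curveDelta (B.chain (n + 1) h).1.range L).toNat < (curveDelta (B.chain n h.of_succ).1.range L).toNat :=
  (Classical.choose_spec (B.exists_point_succ n h (B.chain n h.of_succ).2)).2.2 hsing

/-- **Coherence across stages**: `θₙ (r) = θₖ (r)` for `k ≤ n`, `r ∈ R k`. [OURS · proved] -/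
theorem chain_apply_of_le {k n : ℕ} (hkn : k ≤ n) (h : B.Passes n) (r : P.R k) :
    (B.chain n h).1 (Subring.inclusion (P.le_of_le hkn) r) = (B.chain k (h.of_le hkn)).1 r := by
  induction n, hkn using Nat.le_induction with
  | base => rfl
  | succ n hkn ih =>
    have e : Subring.inclusion (P.le_of_le (Nat.le_succ_of_le hkn)) r =
        Subring.inclusion (P.quadratic n).dominates.1 (Subring.inclusion (P.le_of_le hkn) r) := Subtype.ext rfl
    rw [e, chain_succ_apply, ih h.of_succ]

/-- **`θₙ (x k) ≠ 0` for `k < n`**: the exceptional branch born at stage `k + 1` is not killed by the points of the branch.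
[OURS · proved] -/
theorem chain_chart_ne_zero {k n : ℕ} (hkn : k < n) (h : B.Passes n) :
    (B.chain n h).1 ⟨P.x k, P.le_of_le hkn.le (P.x_mem k)⟩ ≠ 0 := by
  have e : (⟨P.x k, P.le_of_le hkn.le (P.x_mem k)⟩ : P.R n) = Subring.inclusion (P.le_of_le hkn.le) (P.xR k) := Subtype.ext rfl
  rw [e, B.chain_apply_of_le hkn.le h]
  exact B.theta_chart_ne_zero k _ (B.chain k _).2.1 ((h.of_le (Nat.succ_le_of_lt hkn)) (k + 1) le_rfl)

/-- An element not killed by `θₙ` is not divisible by `f n`. [OURS · proved] -/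
theorem not_dvd_of_chain_ne_zero {n : ℕ} (h : B.Passes n) {e : P.R n} (he : (B.chain n h).1 e ≠ 0) : ¬ B.fR n ∣ e := by
  intro hdvd
  apply he
  have hmem : e ∈ RingHom.ker (B.chain n h).1 := by
    rw [(B.chain n h).2.1]; exact Ideal.mem_span_singleton.mpr hdvd
  exact hmem

/-- **Non-vanishing passes to `e / x n`**: if `θₙ (e) ≠ 0` and `e / x n ∈ R (n+1)` then `θₙ₊₁ (e / x n) ≠ 0`. Hence (with
`chain_chart_ne_zero`, `not_dvd_of_chain_ne_zero`) **no strict transform of the branch divides an exceptional branch born along the lineage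
or any of its later strict transforms**. [OURS · proved] -/
theorem chain_div_ne_zero {n : ℕ} (h : B.Passes (n + 1)) {e : K} (heR : e ∈ P.R n)
    (he : (B.chain n h.of_succ).1 ⟨e, heR⟩ ≠ 0) (hex : e / P.x n ∈ P.R (n + 1)) :
    (B.chain (n + 1) h).1 ⟨e / P.x n, hex⟩ ≠ 0 := by
  have hxn : (B.chain (n + 1) h).1 (Subring.inclusion (P.quadratic n).dominates.1 (P.xR n)) ≠ 0 := by
    rw [chain_succ_apply]
    exact B.theta_chart_ne_zero n _ (B.chain n _).2.1 (h (n + 1) le_rfl)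
  have hmul : (B.chain (n + 1) h).1 ⟨e / P.x n, hex⟩ *
      (B.chain (n + 1) h).1 (Subring.inclusion (P.quadratic n).dominates.1 (P.xR n)) =
      (B.chain (n + 1) h).1 (Subring.inclusion (P.quadratic n).dominates.1 ⟨e, heR⟩) := by
    rw [← map_mul]; congr 1
    exact Subtype.ext (by change e / P.x n * P.x n = e; rw [div_mul_cancel₀ _ (P.x_ne_zero n)])
  intro h0
  rw [h0, zero_mul, chain_succ_apply] at hmul
  exact he hmul.symm

/-! ### Two branches -/

/-- **DISTINCT BRANCHES STAY DISTINCT**: for branches `B, C` of the same lineage, `B.f 0 ∤ C.f 0` in `R 0` implies `B.f n ∤ C.f n` in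
`R n` as long as `B` passes through the lineage points `0, …, n` (part 4d `not_dvd_strictTransform` along the chain). With part 4d
`contactOrder_ne_top_of_not_dvd` this supplies the distinctness hypothesis of parts 2–3. [OURS · proved] -/
theorem not_dvd_of_passes {L' : Type w} [Field L'] (C : P.Branch L') (h0 : ¬ B.fR 0 ∣ C.fR 0) {n : ℕ} (h : B.Passes n) :
    ¬ B.fR n ∣ C.fR n := by
  induction n with
  | zero => exact h0
  | succ n ih =>
    have hn := ih h.of_succ
    set θ := B.chain n h.of_succ with hθdef
    obtain ⟨hker, -, -⟩ := θ.2
    have hm := P.frame_eq n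
    have hθx := B.theta_chart_ne_zero n θ.1 hker (h (n + 1) le_rfl)
    obtain ⟨hfm, hfm1⟩ := B.ord_mem_and_not_mem n
    have hst : B.f n / P.x n ^ (contactOrder (0 : P.R n) (B.fR n)).toNat = B.f (n + 1) := (B.f_succ n).symm
    have hf₁mem : B.f n / P.x n ^ (contactOrder (0 : P.R n) (B.fR n)).toNat ∈ P.R (n + 1) := hst ▸ B.f_mem (n + 1)
    have e : (⟨_, hf₁mem⟩ : P.R (n + 1)) = B.fR (n + 1) := Subtype.ext hst
    have hf₁ : (⟨_, hf₁mem⟩ : P.R (n + 1)) ∈ maximalIdeal (P.R (n + 1)) := by rw [e]; exact h (n + 1) le_rfl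
    have hgst : C.f n / P.x n ^ (contactOrder (0 : P.R n) (C.fR n)).toNat = C.f (n + 1) := (C.f_succ n).symm
    have hg₁mem : C.f n / P.x n ^ (contactOrder (0 : P.R n) (C.fR n)).toNat ∈ P.R (n + 1) := hgst ▸ C.f_mem (n + 1)
    have key := not_dvd_strictTransform (P.dim_eq n) hm (P.quadratic n) (P.blowupRing_le n) θ.1 hθx hker hfm hfm1 hf₁
      (g := C.fR n) hn hg₁mem
    have e' : (⟨_, hg₁mem⟩ : P.R (n + 1)) = C.fR (n + 1) := Subtype.ext hgst
    rw [e, e'] at key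
    exact key

/-- **Part 4d's branch lineage theorem for the record**: some strict transform `f N` is a unit or a regular parameter of `R N`.
[OURS · proved] -/
theorem exists_not_mem_or_isRegularBranch : ∃ N, B.fR N ∉ maximalIdeal (P.R N) ∨ IsRegularBranch (P.R N) (B.f N) :=
  exists_not_mem_or_isRegularBranch_of_branchLineage P.R P.isRegular P.dim_eq P.quadratic P.x P.x_mem P.x_mem_maximalIdeal
    P.x_ne_zero P.blowupRing_le B.f B.f_mem B.f_zero_ne B.f_succ B.θ₀ B.ker_θ₀ B.isLocalRingOf_θ₀ B.finite_θ₀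

end PointLineage.Branch

end Summit.ResolutionOfSingularities.ResolutionOfSingularities.Theorems.SigmaMaxModificationsCorridor3.TameLowSnc

end
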